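import Summits.QuantumFields.YangMills.Theorems.BalabanUVNodesN15TwoSpacingGluingNeumannCover
import HarnessLib

/-!
# THE GLUING STEP AT TWO LATTICE SPACINGS, XXV: THE PARTITION LETTERS OF THE CUBE COVER — `|∇h_k| ≤ π∕w`, `|∇⁻h_k| ≤ π∕w`, `|∇*∇h_k| ≤ 32π²∕w²`, the block representative `h̄_k`
# with Lipschitz modulus `ℓ = π(d+1)∕w` and in-block oscillation `ω = π(d+1)∕w`, the two-grid fit `o = π(d+1)∕(nw)` and offset along King's pairing (dag-n15-c g12, FILE 67; N15 =
# NE2, s1 «background-layer OPERATOR ingredient»)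

Cell `pub-ymgap`, seat `pub-ymgap-dag-n15-c` (R134 (a); HUMAN RULING D-0062), generation 12.  `bears_on: R4∕N15 · K3⁷ SpineGivenEndpointR13SepCoPH (stmt-QuantumFields-20544)`.
Filed `--supports stmt-QuantumFields-20544 --as helper` — COUNT-NEUTRAL.  One plumbing `def` (`coverHb`, the block representative), the rest theorems; 0 `sorry`.  Imports BY NAME FILE 66
`…TwoSpacingGluingNeumannCover` (through it FILES 59–61∕65, dag-n15-a N-IIIb, FILE 62); nothing in the tree is modified.

WHY.  The knit's remainder row `[Δ_a, M_{h_k}]∘G(□_k)` is `O(w⁻¹)` because every derivative letter of the partition is: FILE 61 proved `|∇h| ≤ |n|π|s|`, `|∇*∇h| ≤ n²·32π²s²` for ANY sampled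
partition with shift step `s`; FILE 66's cover has `s = (nw)⁻¹`, so `c₁ = π∕w`, `c₂ = 32π²∕w²` (§1).  The NONLOCAL part `N′ = aQ*Q − ∂Π∂*` of `Δ_a` enters through FILE 56's `[N′, M_h] ≤
(ℓ(eε)⁻¹ + 2ω)·c_N·e^{−(δ−ε)d}`, which wants a BLOCK function `h̄` with `|h̄(y) − h̄(y′)| ≤ ℓ·d(y,y′)` and `|h − h̄∘blk| ≤ ω`: §2 takes `h̄_k(y) = h_k` at the block's corner `n·y` and proves
`ℓ = ω = π(d+1)∕w` from FILE 61's modulus of continuity and «circular coordinate distance ≤ torus distance».  §3 is the two-grid fit `|h′_k(x′) − h_k(πx′)| ≤ π(d+1)∕(nw)` along King's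
pairing `π = kingPrV` (FILE 45's `hfit`, rate `(L^k)⁻¹`) and the offset form FILE 64's `hoff` consumes.
* §1 ★ `abs_fgrad_coverH_le` (`π∕w`), ★ `abs_bgrad_coverH_le`, ★ `abs_fgradAdj_fgrad_coverH_le` (`32π²∕w²`), `sum_coverH_sq` ((2.36) on the cover), `abs_coverH_le_one`.
* §2 `abs_cenRep_div_le_circAbs`, `val_up_eq`, `coverXi_up`, def `coverHb`, ★★ `abs_coverHb_sub_le` (Lipschitz `π(d+1)∕w · d_T`), ★★ `abs_coverH_sub_coverHb_le` (oscillation `π(d+1)∕w`).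
* §3 ★★ `abs_coverH_fine_sub_le` (fit `π(d+1)∕(nw)`), ★ `coverXi_offset` (FILE 64's `hoff` with `i = val mod L^r ≤ L^r`, `z = 0`).

HONEST FRAMING ∕ LIMITS.  Elementary real∕lattice bookkeeping over FILES 60–61–66; no operator estimate; [B6] (2.36) p.229 («|∂h_□| ≤ O(1)M⁻¹» = SHAPE, here `M ↦ w`).  `U ≡ 1` doubled-cube
torus MODEL; nothing of [B5]∕[B6]∕[B9] asserted.  NE2⁺ NOT PRINTED, NOT proved; N15 NOT discharged; counts of record UNMOVED (typed 28∕28 · discharged 5∕27); one finite 𝕋⁴ at fixed ε —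
NOT infinite volume, NOT OS on ℝ⁴, NOT a mass gap, NOT Clay; R4 closes the conditional finite-𝕋⁴ rung `BalabanLadder.UV` only.  Restate-immune (no Theses import).
-/

noncomputable section

namespace Summit.QuantumFields.YangMills.BalabanUVNodes.N15.Gluing

open Real
open Literature.MathematicalPhysics.QuantumFieldTheory.Balaban1983to89
open Literature.MathematicalPhysics.QuantumFieldTheory.Balaban1983to89.B5Prop11Plancherel (Tor fine unitVec)
open Literature.MathematicalPhysics.QuantumFieldTheory.Balaban1983to89.B5Block118 (up upHom_intCast)
open Literature.MathematicalPhysics.QuantumFieldTheory.Balaban1983to89.B4TorusKernel.MultiPeriod (circAbs circAbs_add_mul abs_add_mul_centre centre)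
open Literature.MathematicalPhysics.QuantumFieldTheory.Balaban1983to89.B4Sect5Torus (tdist circAbs_le_tdist)
open Literature.MathematicalPhysics.QuantumFieldTheory.King1986.Torus (blockOf val_blockOf tdistT toSite)
open Summit.QuantumFields.YangMills.BalabanUVNodes.N15.BackgroundLayer (fgrad fgradAdj bgrad)
open Summit.QuantumFields.YangMills.BalabanUVNodes.N15.VectorPiece (bshiftEquiv kingPrV kingPr kingPr_val)

variable {d : ℕ}

/-! ## §1 Derivative letters of the cover's partition: `c₁ = π∕w`, `c₂ = 32π²∕w²` -/

section Derivatives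

variable {M : Fin (d + 1) → ℕ} [∀ μ, NeZero (M μ)] {n w q : ℕ} [NeZero n]

omit [∀ μ, NeZero (M μ)] [NeZero n] in
/-- `|h_k| ≤ 1` on the cover (FILE 61). [folklore] -/
theorem abs_coverH_le_one (k : Fin (d + 1) → ZMod (2 * q)) (x : Tor (fine n M) × Fin (d + 1)) : |hcube (2 * q) (coverXi M n w) k x| ≤ 1 :=
  abs_hcube_le_one _ _ k x

omit [∀ μ, NeZero (M μ)] [NeZero n] in
/-- **(2.36) ON THE COVER**: `Σ_k h_k(x)² = 1` (`q ≥ 1`). [cite: Balaban1984PropagatorsII, (2.36) p.229] -/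
theorem sum_coverH_sq [NeZero q] (x : Tor (fine n M) × Fin (d + 1)) : ∑ k : Fin (d + 1) → ZMod (2 * q), hcube (2 * q) (coverXi M n w) k x ^ 2 = 1 :=
  sum_hcube_sq (2 * q) (coverXi M n w) (by have := Nat.pos_of_ne_zero (NeZero.ne q); omega) x

/-- ★ `|∇_μ h_k| ≤ π∕w`. [cite: Balaban1984PropagatorsII, (2.36) p.229 («|∂h_□| ≤ O(1)M⁻¹»: shape)] -/
theorem abs_fgrad_coverH_le (hM : ∀ ν, M ν = 2 * q * w) (hw : 0 < w) (k : Fin (d + 1) → ZMod (2 * q)) (μ : Fin (d + 1)) (x : Tor (fine n M) × Fin (d + 1)) :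
    |fgrad (n : ℝ) (bshiftEquiv M n μ) (hcube (2 * q) (coverXi M n w) k) x| ≤ π / w := by
  have hn : 0 < n := Nat.pos_of_ne_zero (NeZero.ne n)
  have hq : 0 < 2 * q := by
    rcases Nat.eq_zero_or_pos q with h | h
    · subst h; exact absurd (hM μ) (by have := NeZero.ne (M μ); simpa using this)
    · omega
  have h := abs_fgrad_hcube_le (2 * q) (coverXi M n w) (bshiftEquiv M n) hq (coverXi_shift hM hw) (n : ℝ) k μ x
  refine h.trans (le_of_eq ?_)
  rw [abs_of_nonneg (by positivity : (0 : ℝ) ≤ n), abs_of_nonneg (by positivity : (0 : ℝ) ≤ ((n : ℝ) * w)⁻¹)]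
  field_simp

/-- ★ `|∇⁻_μ h_k| ≤ π∕w`. [cite: Balaban1984PropagatorsII, (2.36) p.229 (shape)] -/
theorem abs_bgrad_coverH_le (hM : ∀ ν, M ν = 2 * q * w) (hw : 0 < w) (k : Fin (d + 1) → ZMod (2 * q)) (μ : Fin (d + 1)) (x : Tor (fine n M) × Fin (d + 1)) :
    |bgrad (n : ℝ) (bshiftEquiv M n μ) (hcube (2 * q) (coverXi M n w) k) x| ≤ π / w := by
  have hn : 0 < n := Nat.pos_of_ne_zero (NeZero.ne n)
  have hq : 0 < 2 * q := by
    rcases Nat.eq_zero_or_pos q with h | h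
    · subst h; exact absurd (hM μ) (by have := NeZero.ne (M μ); simpa using this)
    · omega
  have h := abs_bgrad_hcube_le (2 * q) (coverXi M n w) (bshiftEquiv M n) hq (coverXi_shift hM hw) (n : ℝ) k μ x
  refine h.trans (le_of_eq ?_)
  rw [abs_of_nonneg (by positivity : (0 : ℝ) ≤ n), abs_of_nonneg (by positivity : (0 : ℝ) ≤ ((n : ℝ) * w)⁻¹)]
  field_simp

/-- ★ `|∇*_μ∇_μ h_k| ≤ 32π²∕w²` (`q ≥ 1`). [cite: Balaban1984PropagatorsII, (2.36) p.229 («|∂²h_□| ≤ O(1)M⁻²»: shape)] -/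
theorem abs_fgradAdj_fgrad_coverH_le (hM : ∀ ν, M ν = 2 * q * w) (hw : 0 < w) (k : Fin (d + 1) → ZMod (2 * q)) (μ : Fin (d + 1)) (x : Tor (fine n M) × Fin (d + 1)) :
    |fgradAdj (n : ℝ) (bshiftEquiv M n μ) (fgrad (n : ℝ) (bshiftEquiv M n μ) (hcube (2 * q) (coverXi M n w) k)) x| ≤ 32 * π ^ 2 / (w : ℝ) ^ 2 := by
  have hn : 0 < n := Nat.pos_of_ne_zero (NeZero.ne n)
  have hq : 2 ≤ 2 * q := by
    rcases Nat.eq_zero_or_pos q with h | h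
    · subst h; exact absurd (hM μ) (by have := NeZero.ne (M μ); simpa using this)
    · omega
  have hs1 : ((n : ℝ) * w)⁻¹ ≤ 1 := by
    refine inv_le_one_of_one_le₀ ?_
    have : (1 : ℝ) ≤ n := by exact_mod_cast hn
    have : (1 : ℝ) ≤ w := by exact_mod_cast hw
    nlinarith
  have h := abs_fgradAdj_fgrad_hcube_le (2 * q) (coverXi M n w) (bshiftEquiv M n) hq (coverXi_shift hM hw) (by positivity) hs1 (n : ℝ) k μ x
  refine h.trans (le_of_eq ?_)
  field_simp

end Derivatives

/-! ## §2 The block representative: Lipschitz modulus and in-block oscillation `π(d+1)∕w` -/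

section BlockRep

variable {M : Fin (d + 1) → ℕ} [∀ μ, NeZero (M μ)] {n w q : ℕ} [NeZero n]

omit [∀ μ, NeZero (M μ)] [NeZero n] in
/-- `|v_{2q}(z∕w)| ≤ circAbs_{2qw}(z)∕w` for integers `z` (the circle representative at resolution `w` vs. the circular distance on `ℤ∕2qw`). [folklore] -/
theorem abs_cenRep_div_le_circAbs (hq : 0 < 2 * q) (hw : 0 < w) (z : ℤ) : |cenRep (2 * q) ((z : ℝ) / w)| ≤ (circAbs (2 * q * w) z : ℝ) / w := by
  have hw' : (0 : ℝ) < w := by exact_mod_cast hw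
  have hN : 1 ≤ 2 * q * w := by nlinarith
  have h := abs_cenRep_le_abs_sub hq ((z : ℝ) / w) (-centre (2 * q * w) z)
  refine h.trans (le_of_eq ?_)
  rw [← abs_add_mul_centre hN z, eq_div_iff hw'.ne', ← abs_of_pos hw', ← abs_mul, abs_of_pos hw']
  push_cast
  field_simp
  ring

/-- the fine coordinates of a block corner: `val((n·y)_ν) = n·val(y_ν)`. [folklore] -/
theorem val_up_eq (y : Tor M) (ν : Fin (d + 1)) : (up n M y ν).val = n * (y ν).val := by
  have h := B5Blocks16.bpt_val (n := n) (M := M) y (fun _ => (0 : Fin n)) ν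
  have hb : B5Block118.bpt n M y (fun _ => (0 : Fin n)) = up n M y := by
    funext μ; simp [B5Block118.bpt, B5Block118.iota]
  rw [hb] at h
  simpa using h

/-- `ξ_ν` at a block corner: `ξ_ν(n·y) = val(y_ν)∕w`. [folklore] -/
theorem coverXi_up (hw : 0 < w) (y : Tor M) (ν a : Fin (d + 1)) : coverXi M n w ν (up n M y, a) = ((y ν).val : ℝ) / w := by
  have hn : (0 : ℝ) < n := by exact_mod_cast Nat.pos_of_ne_zero (NeZero.ne n)
  unfold coverXi
  rw [show (up n M y, a).1 ν = up n M y ν from rfl, val_up_eq]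
  push_cast
  field_simp

variable (M n w q)

/-- **THE BLOCK REPRESENTATIVE** `h̄_k(y) := h_k(n·y, 0)` — the partition function read at the block's corner (FILE 51∕56's `hb`). [folklore] -/
def coverHb (k : Fin (d + 1) → ZMod (2 * q)) (y : Tor M) : ℝ := hcube (2 * q) (coverXi M n w) k (up n M y, 0)

variable {M n w q}

/-- ★★ **LIPSCHITZ MODULUS OF THE BLOCK REPRESENTATIVE**: `|h̄_k(y) − h̄_k(y′)| ≤ (π(d+1)∕w)·|y − y′|_T` (FILE 56's `hLip`). [cite: Balaban1984PropagatorsI, (1.128) p.38 (|dh| small: shape)] -/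
theorem abs_coverHb_sub_le (hM : ∀ ν, M ν = 2 * q * w) (hw : 0 < w) (k : Fin (d + 1) → ZMod (2 * q)) (y y' : Tor M) :
    |coverHb M n w q k y - coverHb M n w q k y'| ≤ π * (d + 1) / w * tdistT M y y' := by
  have hw' : (0 : ℝ) < w := by exact_mod_cast hw
  have hq : 0 < 2 * q := by
    rcases Nat.eq_zero_or_pos q with h | h
    · subst h; exact absurd (hM 0) (by have := NeZero.ne (M 0); simpa using this)
    · omega
  have hP : ∀ i, 1 ≤ M i := fun i => Nat.one_le_iff_ne_zero.mpr (NeZero.ne (M i))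
  unfold coverHb
  refine (abs_hcube_sub_le (2 * q) (coverXi M n w) hq k _ _).trans ?_
  have hterm : ∀ ν, |cenRep (2 * q) (coverXi M n w ν (up n M y, 0) - coverXi M n w ν (up n M y', 0))| ≤ tdistT M y y' / w := by
    intro ν
    rw [coverXi_up hw, coverXi_up hw, ← sub_div, show ((y ν).val : ℝ) - ((y' ν).val : ℝ) = (((((y ν).val : ℤ) - ((y' ν).val : ℤ)) : ℤ) : ℝ) by push_cast; ring]
    refine (abs_cenRep_div_le_circAbs hq hw _).trans (div_le_div_of_nonneg_right ?_ hw'.le)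
    have := circAbs_le_tdist hP (toSite M y) (toSite M y') ν
    rw [← hM ν]
    exact this
  calc π * ∑ ν, |cenRep (2 * q) (coverXi M n w ν (up n M y, 0) - coverXi M n w ν (up n M y', 0))| ≤ π * ∑ _ν : Fin (d + 1), tdistT M y y' / w :=
        mul_le_mul_of_nonneg_left (Finset.sum_le_sum fun ν _ => hterm ν) pi_pos.le
    _ = π * (d + 1) / w * tdistT M y y' := by
        rw [Finset.sum_const, Finset.card_univ, Fintype.card_fin, nsmul_eq_mul]; push_cast; field_simp

/-- ★★ **IN-BLOCK OSCILLATION**: `|h_k(x) − h̄_k(B(x))| ≤ π(d+1)∕w` (FILE 51∕56's `hosc`∕`hr`: a point and its block's corner differ by `< n` fine steps per coordinate, i.e. `< 1∕w` in `ξ`).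
[cite: Balaban1984PropagatorsII, (2.36) p.229 (shape)] -/
theorem abs_coverH_sub_coverHb_le (hM : ∀ ν, M ν = 2 * q * w) (hw : 0 < w) (k : Fin (d + 1) → ZMod (2 * q)) (x : Tor (fine n M) × Fin (d + 1)) :
    |hcube (2 * q) (coverXi M n w) k x - coverHb M n w q k (blockOf n M x.1)| ≤ π * (d + 1) / w := by
  have hn : 0 < n := Nat.pos_of_ne_zero (NeZero.ne n)
  have hn' : (0 : ℝ) < n := by exact_mod_cast hn
  have hw' : (0 : ℝ) < w := by exact_mod_cast hw
  have hq : 0 < 2 * q := by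
    rcases Nat.eq_zero_or_pos q with h | h
    · subst h; exact absurd (hM 0) (by have := NeZero.ne (M 0); simpa using this)
    · omega
  unfold coverHb
  refine (abs_hcube_sub_le (2 * q) (coverXi M n w) hq k _ _).trans ?_
  have hterm : ∀ ν, |cenRep (2 * q) (coverXi M n w ν x - coverXi M n w ν (up n M (blockOf n M x.1), 0))| ≤ 1 / w := by
    intro ν
    have h0 := abs_cenRep_le_abs_sub hq (coverXi M n w ν x - coverXi M n w ν (up n M (blockOf n M x.1), 0)) 0
    refine h0.trans ?_
    rw [Int.cast_zero, zero_mul, sub_zero, coverXi_up hw, coverXi, val_blockOf]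
    -- `val x_ν − n·⌊val x_ν ∕ n⌋ = val x_ν mod n ∈ [0, n)`
    have hdm := Nat.div_add_mod ((x.1 ν).val) n
    have hlt := Nat.mod_lt ((x.1 ν).val) hn
    have hcast : ((x.1 ν).val : ℝ) / ((n : ℝ) * w) - (((x.1 ν).val / n : ℕ) : ℝ) / w = (((x.1 ν).val % n : ℕ) : ℝ) / ((n : ℝ) * w) := by
      have : ((x.1 ν).val : ℝ) = (n : ℝ) * (((x.1 ν).val / n : ℕ) : ℝ) + (((x.1 ν).val % n : ℕ) : ℝ) := by exact_mod_cast hdm.symm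
      rw [this]; field_simp; ring
    rw [hcast, abs_of_nonneg (by positivity), div_le_div_iff₀ (by positivity) hw']
    have : (((x.1 ν).val % n : ℕ) : ℝ) ≤ n := by exact_mod_cast hlt.le
    nlinarith
  calc π * ∑ ν, |cenRep (2 * q) (coverXi M n w ν x - coverXi M n w ν (up n M (blockOf n M x.1), 0))| ≤ π * ∑ _ν : Fin (d + 1), (1 : ℝ) / w :=
        mul_le_mul_of_nonneg_left (Finset.sum_le_sum fun ν _ => hterm ν) pi_pos.le
    _ = π * (d + 1) / w := by rw [Finset.sum_const, Finset.card_univ, Fintype.card_fin, nsmul_eq_mul]; push_cast; field_simp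

end BlockRep

/-! ## §3 The two-grid fit and offset along King's pairing -/

section Fit

variable {M : Fin (d + 1) → ℕ} [∀ μ, NeZero (M μ)] {L w q : ℕ} [NeZero L] (kk r : ℕ)

/-- the fine and coarse coordinates of a fine bond and its coarse image differ by the remainder: `ξ′_ν(x′) − ξ_ν(πx′) = (val x′_ν mod L^r)∕(L^r L^k w) ∈ [0, (L^k w)⁻¹)`. [cite: King1986, p.664 (the pairing x′ ↦ x)] -/
theorem coverXi_fine_sub_eq (x' : Tor (fine (L ^ r * L ^ kk) M) × Fin (d + 1)) (ν : Fin (d + 1)) :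
    coverXi M (L ^ r * L ^ kk) w ν x' - coverXi M (L ^ kk) w ν (kingPrV L kk r M x') = (((x'.1 ν).val % L ^ r : ℕ) : ℝ) / (((L ^ r * L ^ kk : ℕ) : ℝ) * w) := by
  have hL : 0 < L := Nat.pos_of_ne_zero (NeZero.ne L)
  have hLr : (0 : ℝ) < ((L ^ r : ℕ) : ℝ) := by positivity
  unfold coverXi
  rw [show (kingPrV L kk r M x').1 ν = kingPr L kk r M x'.1 ν from rfl, kingPr_val]
  have hdm := Nat.div_add_mod ((x'.1 ν).val) (L ^ r)
  rcases Nat.eq_zero_or_pos w with hw | hw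
  · subst hw; simp
  have : ((x'.1 ν).val : ℝ) = ((L ^ r : ℕ) : ℝ) * (((x'.1 ν).val / L ^ r : ℕ) : ℝ) + (((x'.1 ν).val % L ^ r : ℕ) : ℝ) := by exact_mod_cast hdm.symm
  rw [this]
  push_cast
  field_simp
  ring

/-- ★★ **THE TWO-GRID FIT OF THE PARTITION** (FILE 45's `hfit`): `|h′_k(x′) − h_k(πx′)| ≤ π(d+1)∕(L^k w)` — rate `(L^k)⁻¹` times `w⁻¹`. [cite: Balaban1985BackgroundPropagators, Thm 3.14 pp.426–427 (difference template: shape)] -/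
theorem abs_coverH_fine_sub_le (hM : ∀ ν, M ν = 2 * q * w) (hw : 0 < w) (k : Fin (d + 1) → ZMod (2 * q)) (x' : Tor (fine (L ^ r * L ^ kk) M) × Fin (d + 1)) :
    |hcube (2 * q) (coverXi M (L ^ r * L ^ kk) w) k x' - hcube (2 * q) (coverXi M (L ^ kk) w) k (kingPrV L kk r M x')| ≤ π * (d + 1) / (((L ^ kk : ℕ) : ℝ) * w) := by
  have hL : 0 < L := Nat.pos_of_ne_zero (NeZero.ne L)
  have hw' : (0 : ℝ) < w := by exact_mod_cast hw
  have hLk : (0 : ℝ) < ((L ^ kk : ℕ) : ℝ) := by positivity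
  have hLr : (0 : ℝ) < ((L ^ r : ℕ) : ℝ) := by positivity
  have hq : 0 < 2 * q := by
    rcases Nat.eq_zero_or_pos q with h | h
    · subst h; exact absurd (hM 0) (by have := NeZero.ne (M 0); simpa using this)
    · omega
  refine (abs_hcube_sub_hcube_le (2 * q) (coverXi M (L ^ r * L ^ kk) w) (coverXi M (L ^ kk) w) hq k x' (kingPrV L kk r M x')).trans ?_
  have hterm : ∀ ν, |cenRep (2 * q) (coverXi M (L ^ r * L ^ kk) w ν x' - coverXi M (L ^ kk) w ν (kingPrV L kk r M x'))| ≤ 1 / (((L ^ kk : ℕ) : ℝ) * w) := by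
    intro ν
    refine (abs_cenRep_le_abs_sub hq _ 0).trans ?_
    rw [Int.cast_zero, zero_mul, sub_zero, coverXi_fine_sub_eq, abs_of_nonneg (by positivity), div_le_div_iff₀ (by positivity) (by positivity)]
    have hlt : (((x'.1 ν).val % L ^ r : ℕ) : ℝ) ≤ ((L ^ r : ℕ) : ℝ) := by exact_mod_cast (Nat.mod_lt _ (pow_pos hL r)).le
    have hmul := mul_le_mul_of_nonneg_right hlt (by positivity : (0 : ℝ) ≤ ((L ^ kk : ℕ) : ℝ) * w)
    push_cast at hmul ⊢
    nlinarith
  calc π * ∑ ν, |cenRep (2 * q) (coverXi M (L ^ r * L ^ kk) w ν x' - coverXi M (L ^ kk) w ν (kingPrV L kk r M x'))| ≤ π * ∑ _ν : Fin (d + 1), 1 / (((L ^ kk : ℕ) : ℝ) * w) :=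
        mul_le_mul_of_nonneg_left (Finset.sum_le_sum fun ν _ => hterm ν) pi_pos.le
    _ = π * (d + 1) / (((L ^ kk : ℕ) : ℝ) * w) := by rw [Finset.sum_const, Finset.card_univ, Fintype.card_fin, nsmul_eq_mul]; push_cast; field_simp

/-- ★ **THE OFFSET ALONG THE PAIRING** (FILE 64's `hoff` with refinement factor `L^r`, fine step `s′ = (L^r L^k w)⁻¹`): `ξ′_ν(x′) = ξ_ν(πx′) + i·s′ + 0·K` with `i = val x′_ν mod L^r ≤ L^r`. [cite: King1986, p.664 (the pairing)] -/
theorem coverXi_offset (ν : Fin (d + 1)) (x' : Tor (fine (L ^ r * L ^ kk) M) × Fin (d + 1)) :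
    ∃ i : ℕ, i ≤ L ^ r ∧ ∃ z : ℤ, coverXi M (L ^ r * L ^ kk) w ν x' = coverXi M (L ^ kk) w ν (kingPrV L kk r M x') + i * (((L ^ r * L ^ kk : ℕ) : ℝ) * w)⁻¹ + z * ((2 * q : ℕ) : ℝ) := by
  have hL : 0 < L := Nat.pos_of_ne_zero (NeZero.ne L)
  refine ⟨(x'.1 ν).val % L ^ r, (Nat.mod_lt _ (pow_pos hL r)).le, 0, ?_⟩
  have h := coverXi_fine_sub_eq (w := w) kk r x' ν
  rw [Int.cast_zero, zero_mul, add_zero, div_eq_mul_inv] at *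
  linarith

end Fit

end Summit.QuantumFields.YangMills.BalabanUVNodes.N15.Gluing

end
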